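import Summits.Ventures.Crystal3D.Theorems.StickyWulffConstantCoaxialWallLawExactCountAbsPlatesCell
import HarnessLib

/-!
# The exact launch-set count WITH THE MOVER'S INVARIANT: the predecessor of every counted end state carries `P` (abstract layer)
# (lane T, crux `TextureLiminfV5`, stmt-Ventures-23912, registered stub `stub_terraceCensus`; (β) assembly — root-class-only bi-family row, HOME/wall-p1-g23/BETA-PLATES-g23.md §4 (2′))

HONEST FRAMING. Venture `Summits/Ventures/Crystal3D` (cell `crystal3d-full`), route `route-Ventures-StickyWulffConstant`, helper `--supports` the law-v5
crux `TextureLiminfV5` (stmt-Ventures-23912), lane T.  ONE combinatorial counting theorem; LATTICE-FREE, census-free, certificate-free; F-C1 not moved.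

THE POINT.  `word_sources_le_exact_launch_cell` (…LevelReachAbs, p739043) VERBATIM — same hypotheses plus `hsrcP : ∀ p ∈ L, P (p, root)` (the invariant
at the launch state itself, true for every geometric instantiation: plate cores and born launch balls have their predecessor present) — with the reachable
end states characterised by a predecessor that CARRIES THE INVARIANT: `∃ u ∈ W, mov u ∧ P u ∧ f u = v` (the orbit invariant is `P v ∧ ∃ u ∈ W, mov u ∧ P u ∧
f u = v`, preserved because every orbit state is in `W`, moving and invariant).  Downstream (…CutSetMover, …PlatesCutMover, …HexagonBarlowMover) this pins the
CLASS OF THE MOVER of every exported end pair (for all-cut censuses: the root class), which is what a ROOT-CLASS-ONLY bi-family row (cf-p1 (ccxcviii) (a2),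
the preferred registered text) can be discharged against.  **`word_sources_le_exact_launch_cell_mover`**.
WHAT THIS IS NOT: any geometric instantiation, any row; F-C1 not moved.
-/

noncomputable section

namespace Summit.Ventures.Crystal3D.Theorems

open Summit.Ventures.Crystal3D Finset
open scoped InnerProductSpace

variable {X : Finset (EuclideanSpace ℝ (Fin 3))}

section Core

variable {K : Type*} {F : K → (EuclideanSpace ℝ (Fin 3) ≃ₗᵢ[ℝ] EuclideanSpace ℝ (Fin 3))}
  {d : K → EuclideanSpace ℝ (Fin 3)}
  {W : Finset (EuclideanSpace ℝ (Fin 3) × K)}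
  {f : EuclideanSpace ℝ (Fin 3) × K → EuclideanSpace ℝ (Fin 3) × K}
  {root : K}
  {P' : Finset (EuclideanSpace ℝ (Fin 3))}
  {R₀ h ρ : ℝ} {M : ℕ} {P : EuclideanSpace ℝ (Fin 3) × K → Prop}

open scoped Classical in
/-- **The exact count with the plates abstracted, sourced from a LAUNCH SET inside the window.**  States `W` are certified balls with a
class (`hW`: the ball is in `X`, reads an occupied `F`-face triple, and has its predecessor `v.1 − d v.2` in `X`), at most `M` per ball
(`hmult`); the move map `f` sends a moving state to a certified state one unit away whose predecessor is the state's ball (`htarget`) and is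
injective on moving states (`hinjW`); the invariant `P` is preserved by moves (`hPmov`); no moving invariant window state steps onto the core
`P'` (`hnoReentry`), which lies below the window (`hP'top`); bottom sealing off the core (`hsealB`) and top sealing + absorption (`hsealT`) as in
`word_sources_le_exact_plates_cell`.  NEW: the sources are the root states `(p, root)` of the balls `p` of a launch set `L` — certified, moving,
stepping straight to `p + d root`, carrying the invariant there (`hsrc`) — with `p + d root ∉ L` (`hLstep`).  CONCLUSION: the launches whose
first step lies inside the window number at most the reachable non-moving invariant window states, plus the RELAUNCHED balls of `L` (those
`p` whose root state `(p, root)` is the `f`-image of a moving invariant window state), plus `M` times the two rim counts. -/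
theorem word_sources_le_exact_launch_cell_mover (mov : EuclideanSpace ℝ (Fin 3) × K → Prop)
    (L : Finset (EuclideanSpace ℝ (Fin 3)))
    (hW : ∀ v, v ∈ W ↔ (v.1 ∈ X ∧
      (∃ a ∈ fccSlots, ∃ a' ∈ fccSlots, ∃ a'' ∈ fccSlots,
        ⟪a, a'⟫_ℝ = 1 / 2 ∧ ⟪a, a''⟫_ℝ = 1 / 2 ∧ ⟪a', a''⟫_ℝ = 1 / 2 ∧
        v.1 + F v.2 a ∈ X ∧ v.1 + F v.2 a' ∈ X ∧ v.1 + F v.2 a'' ∈ X) ∧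
      v.1 - d v.2 ∈ X))
    (hmult : ∀ b ∈ X, (W.filter fun v => v.1 = b).card ≤ M)
    (htarget : ∀ v ∈ W, mov v → f v ∈ W ∧ (f v).1 - d (f v).2 = v.1 ∧ dist v.1 (f v).1 = 1)
    (hinjW : Set.InjOn f {v | v ∈ W ∧ mov v})
    -- (S1') LAUNCHES: the balls of `L` are root states, moving, stepping straight, carrying the invariant after the first step
    (hsrc : ∀ p ∈ L, (p, root) ∈ W ∧ mov (p, root) ∧ f (p, root) = (p + d root, root) ∧ P (p + d root, root))
    (hsrcP : ∀ p ∈ L, P (p, root))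
    (hLstep : ∀ p ∈ L, p + d root ∉ L)
    (hPmov : ∀ v ∈ W, mov v → P v → P (f v))
    -- (S2) NO RE-ENTRY: a moving invariant state INSIDE THE WINDOW never steps onto a core ball
    (hnoReentry : ∀ v ∈ W, mov v → P v → -R₀ - 1 ≤ v.1 2 → v.1 2 < h + R₀ + 1 → (f v).1 ∉ P')
    (hR₀ : 3 ≤ R₀) (hρ : R₀ ≤ ρ)
    (hP'top : ∀ p ∈ P', p 2 ≤ -R₀ - 1)
    -- (S3) BOTTOM SEALING: a ball of `X` strictly below the window, NOT in the core, within lateral `ρ − 1`, at height `≥ −R₀ − 2`: impossible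
    (hsealB : ∀ s ∈ X, s ∉ P' → -R₀ - 1 - 1 ≤ s 2 → s 2 < -R₀ - 1 → s 0 ^ 2 + s 1 ^ 2 ≤ (ρ - 1) ^ 2 → False)
    -- (S4) TOP SEALING + ABSORPTION: a moving invariant window state cannot step to height `≥ h + R₀ + 1` within lateral `ρ − 2`
    (hsealT : ∀ v ∈ W, mov v → P v → -R₀ - 1 ≤ v.1 2 → v.1 2 < h + R₀ + 1 →
      h + R₀ + 1 ≤ (f v).1 2 → (f v).1 2 ≤ h + R₀ + 1 + 1 → (f v).1 0 ^ 2 + (f v).1 1 ^ 2 ≤ (ρ - 2) ^ 2 → False) :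
    (L.filter fun p => -R₀ - 1 < (p + d root) 2 ∧ (p + d root) 2 < h + R₀ + 1).card ≤
      (W.filter fun v => -R₀ - 1 ≤ v.1 2 ∧ v.1 2 < h + R₀ + 1 ∧ ¬ mov v ∧ P v ∧
          ∃ u ∈ W, mov u ∧ P u ∧ f u = v).card +
      (L.filter fun p => ∃ u ∈ W, mov u ∧ P u ∧ -R₀ - 1 ≤ u.1 2 ∧ u.1 2 < h + R₀ + 1 ∧ f u = (p, root)).card +
      M * (X.filter fun s => h + R₀ + 1 ≤ s 2 ∧ s 2 ≤ h + R₀ + 1 + 1 ∧ (ρ - 2) ^ 2 < s 0 ^ 2 + s 1 ^ 2).card +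
      M * (X.filter fun s => -R₀ - 1 - 1 ≤ s 2 ∧ s 2 < -R₀ - 1 ∧ (ρ - 1) ^ 2 < s 0 ^ 2 + s 1 ^ 2).card := by
  have hρ1 : (1 : ℝ) ≤ ρ := by linarith
  set zlo : ℝ := -R₀ - 1 with hzlo
  set zcut : ℝ := h + R₀ + 1 with hzcut
  set SRC := L.filter fun p => -R₀ - 1 < (p + d root) 2 ∧ (p + d root) 2 < h + R₀ + 1 with hSRC
  set S := SRC.image fun p => (p, root) with hS
  set V := (W.filter fun v => zlo ≤ v.1 2 ∧ v.1 2 < zcut ∧ v.1 ∉ P') \ S with hV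
  have hSW : ∀ p ∈ SRC, (p, root) ∈ W := fun p hp => (hsrc p (mem_filter.1 hp).1).1
  have hSmov : ∀ p ∈ SRC, mov (p, root) := fun p hp => (hsrc p (mem_filter.1 hp).1).2.1
  have hSf : ∀ p ∈ SRC, f (p, root) = (p + d root, root) := fun p hp => (hsrc p (mem_filter.1 hp).1).2.2.1
  have hP'top' : ∀ p ∈ P', p 2 ≤ zlo := fun p hp => by rw [hzlo]; exact hP'top p hp
  have hmemV : ∀ v, v ∈ V ↔ (v ∈ W ∧ zlo ≤ v.1 2 ∧ v.1 2 < zcut ∧ v.1 ∉ P') ∧ v ∉ S := by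
    intro v; rw [hV, mem_sdiff, mem_filter, and_assoc]
  have hmemS : ∀ v, v ∈ S ↔ v.1 ∈ SRC ∧ v.2 = root := by
    intro v
    rw [hS, mem_image]
    constructor
    · rintro ⟨p, hp, rfl⟩; exact ⟨hp, rfl⟩
    · rintro ⟨hp, h2⟩; exact ⟨v.1, hp, by rw [← h2]⟩
  -- (1) the orbit-restricted count
  obtain ⟨Q, hQ⟩ : ∃ Q : EuclideanSpace ℝ (Fin 3) × K → Prop, ∀ v, Q v ↔ (P v ∧ ∃ u ∈ W, mov u ∧ P u ∧ f u = v) :=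
    ⟨_, fun v => Iff.rfl⟩
  have hcount := card_sources_le_ends_add_exits_of_invariant V S f mov Q ?inj ?disj ?src ?ps ?pst
  rotate_left
  · -- injectivity on the moving states of `V ∪ S`
    intro x hx y hy hxy
    have hxW : x ∈ W ∧ mov x := by
      rcases hx.1 with h | h
      · exact ⟨((hmemV x).1 h).1.1, hx.2⟩
      · obtain ⟨p, hp, rfl⟩ := mem_image.1 h; exact ⟨hSW p hp, hx.2⟩
    have hyW : y ∈ W ∧ mov y := by
      rcases hy.1 with h | h
      · exact ⟨((hmemV y).1 h).1.1, hy.2⟩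
      · obtain ⟨p, hp, rfl⟩ := mem_image.1 h; exact ⟨hSW p hp, hy.2⟩
    exact hinjW hxW hyW hxy
  · -- launch states are removed from `V`
    rw [Finset.disjoint_left]
    intro s hs hsV
    exact ((hmemV s).1 hsV).2 hs
  · -- sources move into `V`
    intro s hs
    obtain ⟨p, hp, rfl⟩ := mem_image.1 hs
    refine ⟨hSmov p hp, ?_⟩
    obtain ⟨hpL, hlo, hhi⟩ := mem_filter.1 hp
    have hfv : f (p, root) = (p + d root, root) := hSf p hp
    obtain ⟨hW', -, -⟩ := htarget _ (hSW p hp) (hSmov p hp)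
    rw [hfv] at hW' ⊢
    rw [hmemV]
    refine ⟨⟨hW', by rw [hzlo]; linarith, by rw [hzcut]; linarith, fun hP => ?_⟩, fun hmem => ?_⟩
    · have := hP'top' _ hP
      simp only at this
      linarith
    · exact hLstep p hpL (mem_filter.1 ((hmemS _).1 hmem).1).1
  · -- the invariant at the first image of a source
    intro s hs
    obtain ⟨p, hp, rfl⟩ := mem_image.1 hs
    obtain ⟨hpL, -, -⟩ := mem_filter.1 hp
    refine (hQ _).2 ⟨?_, (p, root), hSW p hp, hSmov p hp, hsrcP p hpL, rfl⟩
    rw [hSf p hp]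
    exact (hsrc p hpL).2.2.2
  · -- the invariant is preserved inside the window
    intro v hv hm _ hP
    exact (hQ _).2 ⟨hPmov v ((hmemV v).1 hv).1.1 hm ((hQ v).1 hP).1, v, ((hmemV v).1 hv).1.1, hm, ((hQ v).1 hP).1, rfl⟩
  -- (2) the number of sources
  have hScard : S.card = SRC.card := by
    rw [hS, card_image_of_injective]
    intro p q hpq; exact (Prod.mk.inj hpq).1
  obtain ⟨E₁, E₂, hcount', hE₁, hE₂⟩ : ∃ E₁ E₂ : Finset (EuclideanSpace ℝ (Fin 3) × K),
      S.card ≤ E₁.card + E₂.card ∧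
      (∀ v, v ∈ E₁ ↔ v ∈ V ∧ (¬ mov v ∧ Q v)) ∧ (∀ v, v ∈ E₂ ↔ v ∈ V ∧ (mov v ∧ f v ∉ V ∧ Q v)) :=
    ⟨_, _, hcount, fun v => mem_filter, fun v => mem_filter⟩
  -- (3) the reachable ends, uncharged
  have hends : E₁.card ≤
      (W.filter fun v => zlo ≤ v.1 2 ∧ v.1 2 < zcut ∧ ¬ mov v ∧ P v ∧ ∃ u ∈ W, mov u ∧ P u ∧ f u = v).card := by
    refine card_le_card fun v hv => ?_
    obtain ⟨hvV, hnm, hQv⟩ := (hE₁ v).1 hv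
    obtain ⟨hPv, hu⟩ := (hQ v).1 hQv
    obtain ⟨⟨hvW, h1, h2, -⟩, -⟩ := (hmemV v).1 hvV
    exact mem_filter.2 ⟨hvW, h1, h2, hnm, hPv, hu⟩
  -- (4) exits (reachable: they carry the invariant)
  set EX := V.filter fun v => mov v ∧ f v ∉ V ∧ Q v with hEX
  set RIMT := X.filter fun s => zcut ≤ s 2 ∧ s 2 ≤ zcut + 1 ∧ (ρ - 2) ^ 2 < s 0 ^ 2 + s 1 ^ 2 with hRIMT
  set RIMB := X.filter fun s => zlo - 1 ≤ s 2 ∧ s 2 < zlo ∧ (ρ - 1) ^ 2 < s 0 ^ 2 + s 1 ^ 2 with hRIMB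
  set LRE := L.filter fun p => ∃ u ∈ W, mov u ∧ P u ∧ zlo ≤ u.1 2 ∧ u.1 2 < zcut ∧ f u = (p, root) with hLRE
  have hexit : ∀ v ∈ EX, v ∈ W ∧ mov v ∧ zlo ≤ v.1 2 ∧ v.1 2 < zcut ∧ f v ∈ W ∧
      (f v).1 - d (f v).2 = v.1 ∧ dist v.1 (f v).1 = 1 ∧ P v ∧
      ((f v).1 2 < zlo ∨ zcut ≤ (f v).1 2 ∨ (f v).1 ∈ P' ∨ f v ∈ S) := by
    intro v hv
    obtain ⟨hvV, hm, hnot, hQv⟩ := mem_filter.1 hv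
    obtain ⟨⟨hvW, h1, h2, -⟩, -⟩ := (hmemV v).1 hvV
    obtain ⟨hW', hback, hdist⟩ := htarget v hvW hm
    refine ⟨hvW, hm, h1, h2, hW', hback, hdist, ((hQ v).1 hQv).1, ?_⟩
    by_contra hno
    push Not at hno
    exact hnot ((hmemV _).2 ⟨⟨hW', hno.1, hno.2.1, hno.2.2.1⟩, hno.2.2.2⟩)
  have hvert : ∀ v ∈ EX, |(f v).1 2 - v.1 2| ≤ 1 := by
    intro v hv
    obtain ⟨-, -, -, -, -, -, hdist, -⟩ := hexit v hv
    have h1 := sq_sub_apply_le_dist_sq (f v).1 v.1 2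
    rw [dist_comm, hdist, one_pow] at h1
    rw [← sq_le_one_iff_abs_le_one]; exact h1
  have hnoP' : ∀ v ∈ EX, (f v).1 ∉ P' := by
    intro v hv
    obtain ⟨hvW, hm, hlo, hhi, -, -, -, hPv, -⟩ := hexit v hv
    exact hnoReentry v hvW hm hPv hlo hhi
  have hbot : ∀ v ∈ EX, (f v).1 2 < zlo → (f v).1 ∈ RIMB := by
    intro v hv hlt
    obtain ⟨-, -, h1, -, hW', -, -, -, -⟩ := hexit v hv
    have hab := abs_le.1 (hvert v hv)
    have hsX : (f v).1 ∈ X := ((hW _).1 hW').1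
    rw [hRIMB, mem_filter]
    refine ⟨hsX, by linarith [hab.1], hlt, ?_⟩
    by_contra hlat
    push Not at hlat
    exact hsealB _ hsX (hnoP' v hv) (by rw [hzlo] at hlt h1; linarith [hab.1]) (by rw [hzlo] at hlt; exact hlt) hlat
  have htopc : ∀ v ∈ EX, zcut ≤ (f v).1 2 → (f v).1 ∈ RIMT := by
    intro v hv hge
    by_contra hnr
    obtain ⟨hvW0, hm0, h1, h2, hW', hback, -, hPv, -⟩ := hexit v hv
    have hab := abs_le.1 (hvert v hv)
    have hsX : (f v).1 ∈ X := ((hW _).1 hW').1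
    have hs2 : (f v).1 2 ≤ zcut + 1 := by linarith [hab.2]
    have hlat : (f v).1 0 ^ 2 + (f v).1 1 ^ 2 ≤ (ρ - 2) ^ 2 := by
      by_contra hlt; push Not at hlt
      exact hnr (by rw [hRIMT, mem_filter]; exact ⟨hsX, hge, hs2, hlt⟩)
    exact hsealT v hvW0 hm0 hPv h1 h2 (by rw [hzcut] at hge; exact hge) (by rw [hzcut] at hs2; exact hs2) hlat
  have hrel : ∀ v ∈ EX, f v ∈ S → (f v).1 ∈ LRE := by
    intro v hv hfS
    obtain ⟨hvW, hm, h1, h2, -, -, -, hPv, -⟩ := hexit v hv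
    obtain ⟨hp, h2r⟩ := (hmemS _).1 hfS
    rw [hLRE, mem_filter]
    refine ⟨(mem_filter.1 hp).1, v, hvW, hm, hPv, h1, h2, ?_⟩
    exact Prod.ext rfl h2r
  -- (5) counting the exits
  have hEXinj : Set.InjOn f ↑EX := by
    intro x hx y hy hxy
    have hx' := mem_filter.1 (Finset.mem_coe.1 hx)
    have hy' := mem_filter.1 (Finset.mem_coe.1 hy)
    exact hinjW ⟨((hmemV _).1 hx'.1).1.1, hx'.2.1⟩ ⟨((hmemV _).1 hy'.1).1.1, hy'.2.1⟩ hxy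
  have hfibre : ∀ T : Finset (EuclideanSpace ℝ (Fin 3)), T ⊆ X →
      (W.filter fun v => v.1 ∈ T).card ≤ M * T.card := by
    intro T hT
    have hcov : (W.filter fun v => v.1 ∈ T) ⊆ T.biUnion fun s => W.filter fun v => v.1 = s := by
      intro v hv
      rw [mem_biUnion]
      exact ⟨v.1, (mem_filter.1 hv).2, mem_filter.2 ⟨(mem_filter.1 hv).1, rfl⟩⟩
    refine (card_le_card hcov).trans (card_biUnion_le.trans ?_)
    calc ∑ s ∈ T, (W.filter fun v => v.1 = s).card ≤ ∑ s ∈ T, M := sum_le_sum fun s hs => hmult s (hT hs)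
      _ = M * T.card := by rw [sum_const, smul_eq_mul, mul_comm]
  have hexits : EX.card ≤ LRE.card + M * RIMT.card + M * RIMB.card := by
    set EXR := EX.filter fun v => (f v).1 ∈ RIMT with hEXR
    set EXB := EX.filter fun v => (f v).1 ∈ RIMB with hEXB
    set EXL := EX.filter fun v => f v ∈ S with hEXL
    have hsplit : EX ⊆ EXL ∪ (EXR ∪ EXB) := by
      intro v hv
      obtain ⟨-, -, -, -, -, -, -, -, hcase⟩ := hexit v hv
      rw [mem_union, mem_union]
      rcases hcase with hlt | hge | hP | hrl
      · exact Or.inr (Or.inr (mem_filter.2 ⟨hv, hbot v hv hlt⟩))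
      · exact Or.inr (Or.inl (mem_filter.2 ⟨hv, htopc v hv hge⟩))
      · exact absurd hP (hnoP' v hv)
      · exact Or.inl (mem_filter.2 ⟨hv, hrl⟩)
    have h1 : EXL.card ≤ LRE.card := by
      have hle : EXL.card ≤ (LRE.image fun p => (p, root)).card := by
        refine card_le_card_of_injOn f (fun v hv => ?_) fun x hx y hy hxy =>
          hEXinj (Finset.mem_coe.2 (mem_filter.1 (Finset.mem_coe.1 hx)).1)
            (Finset.mem_coe.2 (mem_filter.1 (Finset.mem_coe.1 hy)).1) hxy
        obtain ⟨hvE, hfS⟩ := mem_filter.1 hv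
        obtain ⟨-, h2r⟩ := (hmemS _).1 hfS
        exact mem_image.2 ⟨(f v).1, hrel v hvE hfS, Prod.ext rfl h2r.symm⟩
      exact hle.trans card_image_le
    have h2 : EXR.card ≤ M * RIMT.card := by
      refine le_trans ?_ (hfibre RIMT (filter_subset _ _))
      refine card_le_card_of_injOn f (fun v hv => ?_) fun x hx y hy hxy =>
        hEXinj (Finset.mem_coe.2 (mem_filter.1 (Finset.mem_coe.1 hx)).1)
          (Finset.mem_coe.2 (mem_filter.1 (Finset.mem_coe.1 hy)).1) hxy
      obtain ⟨hvE, hr'⟩ := mem_filter.1 hv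
      obtain ⟨-, -, -, -, hW', -, -, -, -⟩ := hexit v hvE
      exact mem_filter.2 ⟨hW', hr'⟩
    have h3 : EXB.card ≤ M * RIMB.card := by
      refine le_trans ?_ (hfibre RIMB (filter_subset _ _))
      refine card_le_card_of_injOn f (fun v hv => ?_) fun x hx y hy hxy =>
        hEXinj (Finset.mem_coe.2 (mem_filter.1 (Finset.mem_coe.1 hx)).1)
          (Finset.mem_coe.2 (mem_filter.1 (Finset.mem_coe.1 hy)).1) hxy
      obtain ⟨hvE, hr'⟩ := mem_filter.1 hv
      obtain ⟨-, -, -, -, hW', -, -, -, -⟩ := hexit v hvE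
      exact mem_filter.2 ⟨hW', hr'⟩
    calc EX.card ≤ (EXL ∪ (EXR ∪ EXB)).card := card_le_card hsplit
      _ ≤ EXL.card + (EXR ∪ EXB).card := card_union_le _ _
      _ ≤ EXL.card + (EXR.card + EXB.card) := by gcongr; exact card_union_le _ _
      _ ≤ LRE.card + M * RIMT.card + M * RIMB.card := by linarith
  -- (6) assemble
  rw [← hScard]
  have hE₂EX : E₂.card ≤ EX.card := by
    refine card_le_card fun v hv => ?_
    obtain ⟨hvV, hm, hfv, hQv⟩ := (hE₂ v).1 hv
    rw [hEX, mem_filter]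
    exact ⟨hvV, hm, hfv, hQv⟩
  calc S.card ≤ E₁.card + E₂.card := hcount'
    _ ≤ _ := by
      rw [hzlo, hzcut] at hends
      rw [hLRE, hRIMT, hRIMB, hzlo, hzcut] at hexits
      linarith [hends, hexits, hE₂EX]

end Core

end Summit.Ventures.Crystal3D.Theorems

end
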